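import Mathlib.Combinatorics.Enumerative.DoubleCounting
import Mathlib.Tactic.Group
import Mathlib.Algebra.Group.Subgroup.Finite
import Literature.Combinatorics.Additive.TripleProductProperty

/-!
# ω-census, family (b3): counting TPP volume through the coset fibres of a subgroup

HONEST FRAMING (pub-omega census; verbatim): lottery ticket; floor = certified bounds/negative ranges.
Census BOOKKEEPING, the generic half of the fibre method of `CentreIndexFourTPP.lean` (there with the fibres `{g, g z}` of `⟨z⟩`):
for a finite group `G`, a subgroup `K` and ANY finite set `V` of cells `(s, t, u)`, counting each cell at the `|K|` elements of the coset
`s t u · K` gives `|K| · #V = Σ_g #{P ∈ V : g⁻¹ · s t u ∈ K}`; hence a uniform bound `m` on the fibres yields `|K| · #V ≤ m · |G|`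
(`card_mul_le_of_fibre_bound`), and for `V = S × T × U` the TPP-volume form `|K| · |S||T||U| ≤ m · |G|` (`volume_mul_card_le_of_fibre_bound`).
The per-fibre bounds are the group-specific part (`SmallComm.fibre_card_le_three` for `[G : Z(G)] = 4` with `K = {1, z}`, `m = 3`; for the class
`[G : Z(G)] = 6` the cell's prereg P-028 records `K = G'` of order `3`, `m = 5` at engine grade).  Nothing here bears on `ω`.
-/

open Finset

namespace Summit.MatrixMultiplication.OmegaCensus.CosetFibre

variable {G : Type*} [Group G] [Fintype G] [DecidableEq G]

/-- The product `s t u` of a cell `(s, t, u)`. [folklore] -/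
def key (P : G × G × G) : G := P.1 * P.2.1 * P.2.2

/-- The fibre of `g` for the subgroup `K`: the cells of `V` whose product lies in the coset `g K`. [folklore] -/
def fibre (K : Subgroup G) [DecidablePred (· ∈ K)] (V : Finset (G × G × G)) (g : G) : Finset (G × G × G) :=
  V.filter fun P => g⁻¹ * key P ∈ K

/-- Each cell is counted at exactly `|K|` group elements: `#{g : g⁻¹ · key P ∈ K} = |K|`. [folklore] -/
theorem card_filter_inv_mul_key_mem (K : Subgroup G) [DecidablePred (· ∈ K)] (P : G × G × G) :
    #((univ : Finset G).filter fun g => g⁻¹ * key P ∈ K) = Fintype.card K := by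
  classical
  have : ((univ : Finset G).filter fun g => g⁻¹ * key P ∈ K) = ((univ : Finset G).filter (· ∈ K)).image fun k => key P * k⁻¹ := by
    ext g
    simp only [mem_filter, mem_univ, true_and, mem_image]
    constructor
    · intro hg
      exact ⟨g⁻¹ * key P, hg, by group⟩
    · rintro ⟨k, hk, rfl⟩
      simpa using K.inv_mem (K.inv_mem hk)
  rw [this, card_image_of_injective _ (fun a b h => by simpa using h), Fintype.card_subtype]

/-- **Coset fibre count.** If every fibre holds at most `m` cells of `V`, then `|K| · #V ≤ m · |G|`. [folklore] -/
theorem card_mul_le_of_fibre_bound (K : Subgroup G) [DecidablePred (· ∈ K)] (V : Finset (G × G × G)) (m : ℕ)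
    (h : ∀ g : G, #(fibre K V g) ≤ m) : Fintype.card K * #V ≤ m * Fintype.card G := by
  classical
  let r : (G × G × G) → G → Prop := fun P g => g⁻¹ * key P ∈ K
  have hL : ∀ P ∈ V, #((univ : Finset G).bipartiteAbove r P) = Fintype.card K := fun P _ =>
    card_filter_inv_mul_key_mem K P
  calc Fintype.card K * #V = ∑ P ∈ V, #((univ : Finset G).bipartiteAbove r P) := by rw [sum_const_nat hL, mul_comm]
    _ = ∑ g ∈ (univ : Finset G), #(V.bipartiteBelow r g) := sum_card_bipartiteAbove_eq_sum_card_bipartiteBelow _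
    _ ≤ ∑ g ∈ (univ : Finset G), m := sum_le_sum fun g _ => h g
    _ = m * Fintype.card G := by rw [sum_const, card_univ, smul_eq_mul, mul_comm]

/-- **TPP-volume form.** For `V = S × T × U`: if every coset fibre of `K` holds at most `m` triples then `|K| · |S||T||U| ≤ m · |G|`. [folklore] -/
theorem volume_mul_card_le_of_fibre_bound (K : Subgroup G) [DecidablePred (· ∈ K)] (S T U : Finset G) (m : ℕ)
    (h : ∀ g : G, #(fibre K (S ×ˢ (T ×ˢ U)) g) ≤ m) : Fintype.card K * (#S * #T * #U) ≤ m * Fintype.card G := by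
  have := card_mul_le_of_fibre_bound K (S ×ˢ (T ×ˢ U)) m h
  rw [card_product, card_product] at this
  simpa only [mul_assoc] using this

end Summit.MatrixMultiplication.OmegaCensus.CosetFibre
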